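import Mathlib.NumberTheory.Chebyshev
import Mathlib.NumberTheory.Primorial
import Mathlib.Analysis.Complex.ExponentialBounds
import Mathlib.FieldTheory.Finite.Basic
import Mathlib.Data.ZMod.Basic
import Mathlib.Data.Nat.Size
import HarnessLib

/-!
# Small primes for Chinese remaindering: a Chebyshev prime supply, discrete-logarithm
representation of products modulo a prime, and CRT reconstruction with an approximate quotient

Number-theoretic tools behind the constant-depth threshold circuits for iterated
multiplication / modular exponentiation (`ITMULT ≤cd MAJ`, Vollmer 1999, §1.4.2, Thm. 1.40,
originally Beame–Cook–Hoover 1986 and Chandra–Stockmeyer–Vishkin 1984; used by Naor–Reingold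
2004, §4.2 and Thm. 4.5): a product of many numbers is computed through its residues modulo
polynomially many SMALL primes, each residue being obtained from DISCRETE LOGARITHMS modulo that
prime (so that a product becomes a small sum — Vollmer's eq. (1.5),
`m_j(a₁⋯aₙ mod p_j) = (∑ᵢ m_j(aᵢ mod p_j)) mod (p_j − 1)` — i.e. one threshold computation), and
the number is recovered by the Chinese Remainder Theorem (Vollmer's eq. (1.7),
`a' = ∑_j (a mod p_j) r_j s_j`, `a = a' − q·p`). Everything here is arithmetic (no circuits);
all statements are proved.

* **Prime supply** (`two_pow_le_primorial`, from Mathlib's Chebyshev bound `Chebyshev.theta_ge`):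
  for `n ≥ 2^24` and `2k ≤ n`, `2^k ≤ primorial n` — the product of the primes `≤ n` has at least
  `n/2` bits, so `B`-bit numbers are determined by their residues modulo the primes below
  `primeBound B = 2B + 2^24 + 8`, a LINEAR bound (`four_mul_two_pow_lt_primorial`; Vollmer uses
  the first `n²` primes and the Prime Number Theorem, Appendix A7).
* **Discrete logarithms modulo a prime** (`exists_dlogData`): a generator `γ` of `(ℤ/p)ˣ` and a
  logarithm `dlog : ZMod p → ℕ`, `dlog c < p`, `γ ^ dlog c = c` for `c ≠ 0` (Vollmer's `g_j`,
  `m_j`); hence a product of non-zero residues is `γ ^ (∑ dlog)` (`prod_eq_pow_sum_dlog`,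
  `prod_mod_eq`; "the particular case that one of the `aᵢ mod p_j` is equal to `0` can easily
  be taken care of").
* **CRT tables** for a finite set `S` of primes with product `M` (`crtT S p r`: the number
  `< M` that is `≡ r (mod p)` and `≡ 0 (mod q)` for `q ∈ S ∖ {p}` — Vollmer's `r_j s_j`), the
  reconstruction `E % M = (∑_{p ∈ S} crtT S p (E % p)) % M` (`crtSum_mod`), the quotient
  `κ = (∑ crtT) / M ≤ |S|` (`crtK_lt`; Vollmer's `q`, "polynomial in `n`") with
  `∑ crtT = κ M + E` for `E < M` (`crtSum_eq`), and an **approximate quotient formula**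
  (`crtK_eq_approx`, folklore): if `4E < M` then
  `κ = (∑_{p ∈ S} ⌊crtT S p (E % p) · 2^b / M⌋ + |S|) / 2^b` for `2^b = 2^{size (2|S|)}`, so that
  `κ` is read off a SMALL weighted sum of the residue indicators (weights `< 2^b ≤ 4|S| + 1`)
  instead of Vollmer's parallel comparisons `i·p ≤ a' < (i+1)·p` on the binary value of `a'`
  (which would need an iterated addition first); cf. Naor–Reingold 2004, §4.2.1 (p. 252):
  "computing values `rᵢ` (obtained by the CRT-representation) … is just as good".

## References

* H. Vollmer, *Introduction to Circuit Complexity* (1999), §1.4.2, Thm. 1.40 and its proof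
  (eqs. (1.2)–(1.7)), Appendix A7–A8.
* P. Beame, S. Cook, H. J. Hoover, *Log depth circuits for division and related problems*,
  SIAM J. Comput. 15 (1986) 994–1003 (the original CRT / discrete-logarithm circuits).
* M. Naor, O. Reingold, *Number-theoretic constructions of efficient pseudo-random functions*,
  J. ACM 51 (2004), §4.2 and §4.2.1 (p. 252).
* Mathlib: `Mathlib.NumberTheory.Chebyshev` (`Chebyshev.theta_ge`, `theta_eq_log_primorial`).
-/

noncomputable section

namespace Literature.Computability.Complexity

open Finset Real

namespace SmallPrimes

/-! ### A Chebyshev prime supply -/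

/-- For `x ≥ 2^24`: `log (x+1) + 2 √x log x ≤ (13/64) x`. [folklore] -/
theorem error_le {x : ℝ} (hx : (2 : ℝ) ^ 24 ≤ x) :
    Real.log (x + 1) + 2 * √x * Real.log x ≤ 13 / 64 * x := by
  have hx1 : (1 : ℝ) ≤ x := le_trans (by norm_num) hx
  have hx0 : (0 : ℝ) ≤ x := le_trans zero_le_one hx1
  have hxpos : (0 : ℝ) < x := lt_of_lt_of_le zero_lt_one hx1
  -- `log x ≤ 4 x^{1/4}`
  have hlog : Real.log x ≤ 4 * x ^ (1 / 4 : ℝ) := by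
    have := Real.log_le_rpow_div hx0 (by norm_num : (0 : ℝ) < 1 / 4)
    linarith [this]
  -- `x^{1/4} ≥ 64`
  have h14 : (64 : ℝ) ≤ x ^ (1 / 4 : ℝ) := by
    have h64 : ((64 : ℝ) ^ (4 : ℕ)) ^ (1 / 4 : ℝ) = 64 := by
      rw [← Real.rpow_natCast, ← Real.rpow_mul (by norm_num)]
      norm_num
    have : (64 : ℝ) ^ (4 : ℕ) ≤ x := le_trans (by norm_num) hx
    calc (64 : ℝ) = ((64 : ℝ) ^ (4 : ℕ)) ^ (1 / 4 : ℝ) := h64.symm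
      _ ≤ x ^ (1 / 4 : ℝ) := Real.rpow_le_rpow (by positivity) this (by norm_num)
  -- `x = x^{3/4} x^{1/4}`, so `64 x^{3/4} ≤ x`
  have hsplit : x ^ (3 / 4 : ℝ) * x ^ (1 / 4 : ℝ) = x := by
    rw [← Real.rpow_add hxpos]; norm_num
  have h34pos : 0 ≤ x ^ (3 / 4 : ℝ) := Real.rpow_nonneg hx0 _
  have h34 : 64 * x ^ (3 / 4 : ℝ) ≤ x := by nlinarith
  -- `√x log x ≤ 4 x^{3/4}`
  have hsqrt : √x * Real.log x ≤ 4 * x ^ (3 / 4 : ℝ) := by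
    rw [Real.sqrt_eq_rpow]
    have e : x ^ (1 / 2 : ℝ) * x ^ (1 / 4 : ℝ) = x ^ (3 / 4 : ℝ) := by
      rw [← Real.rpow_add hxpos]; norm_num
    calc x ^ (1 / 2 : ℝ) * Real.log x ≤ x ^ (1 / 2 : ℝ) * (4 * x ^ (1 / 4 : ℝ)) :=
          mul_le_mul_of_nonneg_left hlog (Real.rpow_nonneg hx0 _)
      _ = 4 * x ^ (3 / 4 : ℝ) := by rw [← e]; ring
  -- `log (x+1) ≤ log 2 + log x ≤ 1 + 4 x^{1/4} ≤ 1 + 4 x^{3/4}`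
  have hlog1 : Real.log (x + 1) ≤ 1 + 4 * x ^ (3 / 4 : ℝ) := by
    have h1 : Real.log (x + 1) ≤ Real.log (2 * x) :=
      Real.log_le_log (by linarith) (by linarith)
    rw [Real.log_mul (by norm_num) hxpos.ne'] at h1
    have h2 : Real.log 2 ≤ 1 := le_trans Real.log_two_lt_d9.le (by norm_num)
    have h3 : x ^ (1 / 4 : ℝ) ≤ x ^ (3 / 4 : ℝ) :=
      Real.rpow_le_rpow_of_exponent_le hx1 (by norm_num)
    linarith
  have hone : (1 : ℝ) ≤ x ^ (3 / 4 : ℝ) := Real.one_le_rpow hx1 (by norm_num)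
  nlinarith

/-- **Chebyshev, halved**: `θ(n) ≥ (n log 2)/2` for `n ≥ 2^24` (from Mathlib's `Chebyshev.theta_ge` by constant bookkeeping). [folklore] -/
theorem theta_ge_half {n : ℕ} (hn : 2 ^ 24 ≤ n) : (n : ℝ) * Real.log 2 / 2 ≤ Chebyshev.theta n := by
  have h := Chebyshev.theta_ge n
  have hx : (2 : ℝ) ^ 24 ≤ n := by exact_mod_cast hn
  have herr := error_le hx
  have hlog2 : (0.6931471803 : ℝ) < Real.log 2 := Real.log_two_gt_d9
  have hn0 : (0 : ℝ) ≤ n := Nat.cast_nonneg n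
  nlinarith

/-- **Prime supply**: for `n ≥ 2^24` and `2k ≤ n`, the product of the primes `≤ n` is at least
`2^k` (Chebyshev's bound, via Mathlib's `Chebyshev.theta_eq_log_primorial`). [folklore] -/
theorem two_pow_le_primorial {n k : ℕ} (hn : 2 ^ 24 ≤ n) (hk : 2 * k ≤ n) : 2 ^ k ≤ primorial n := by
  have h1 := theta_ge_half hn
  rw [Chebyshev.theta_eq_log_primorial, Nat.floor_natCast] at h1
  have hprim : (0 : ℝ) < primorial n := by exact_mod_cast primorial_pos n
  have hk' : (k : ℝ) * Real.log 2 ≤ (n : ℝ) * Real.log 2 / 2 := by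
    have : (2 * k : ℝ) ≤ n := by exact_mod_cast hk
    have := Real.log_pos (one_lt_two : (1:ℝ) < 2)
    nlinarith
  have h2 : Real.log ((2 : ℝ) ^ k) ≤ Real.log (primorial n) := by
    rw [Real.log_pow]; linarith
  have h3 := (Real.log_le_log_iff (by positivity) hprim).1 h2
  exact_mod_cast h3

/-- The prime bound for `B`-bit Chinese remaindering: `2B + 2^24 + 8` (linear in `B`). [folklore] -/
def primeBound (B : ℕ) : ℕ := 2 * B + 2 ^ 24 + 8

/-- **Enough small primes**: `4 · 2^B < ∏_{p ≤ primeBound B} p` (Chebyshev; Vollmer uses the first `n²` primes instead, Appendix A7). [folklore] -/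
theorem four_mul_two_pow_lt_primorial (B : ℕ) : 4 * 2 ^ B < primorial (primeBound B) := by
  have h := two_pow_le_primorial (n := primeBound B) (k := B + 3) (by unfold primeBound; omega)
    (by unfold primeBound; omega)
  have h8 : 4 * 2 ^ B < 2 ^ (B + 3) := by
    have := Nat.two_pow_pos B
    rw [pow_add, show (2 : ℕ) ^ 3 = 8 by norm_num]; linarith
  exact h8.trans_le h

/-- The set of primes used: all primes `≤ primeBound B`. [folklore] -/
def primeSet (B : ℕ) : Finset ℕ := (range (primeBound B + 1)).filter Nat.Prime

/-- Its product is the primorial. [folklore] -/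
theorem prod_primeSet (B : ℕ) : ∏ p ∈ primeSet B, p = primorial (primeBound B) := rfl

/-- Members are primes `≤ primeBound B`. [folklore] -/
theorem mem_primeSet {B p : ℕ} : p ∈ primeSet B ↔ p < primeBound B + 1 ∧ p.Prime := by
  simp [primeSet]

/-! ### Discrete logarithms modulo a prime -/

/-- Discrete-logarithm data modulo a prime `p`: a generator `γ` of the non-zero residues and a
logarithm function with `γ ^ dlog c = c` for `c ≠ 0`, `dlog c < p` (Vollmer's `g_j`, `m_j`). [cite: Vollmer1999, §1.4.2, proof of Thm. 1.40 (generators `g_j`, logarithms `m_j`)] -/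
structure DlogData (p : ℕ) where
  /-- the generator -/
  γ : ZMod p
  /-- the generator is non-zero -/
  γ_ne : γ ≠ 0
  /-- the discrete logarithm (junk `0` at `0`) -/
  dlog : ZMod p → ℕ
  /-- logarithms are small -/
  dlog_lt : ∀ c, dlog c < p
  /-- `γ ^ dlog c = c` for `c ≠ 0` -/
  pow_dlog : ∀ c, c ≠ 0 → γ ^ dlog c = c

/-- **Existence of discrete logarithms modulo a prime** (the unit group of `ℤ/p` is cyclic). [cite: Vollmer1999, §1.4.2, proof of Thm. 1.40, and Appendix A8] -/
theorem exists_dlogData (p : ℕ) [hp : Fact p.Prime] : Nonempty (DlogData p) := by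
  classical
  obtain ⟨g, hg⟩ := IsCyclic.exists_generator (α := (ZMod p)ˣ)
  have hord : orderOf g ≤ p - 1 := by
    rw [← ZMod.card_units p]; exact orderOf_le_card_univ
  -- every unit is a small power of `g`
  have key : ∀ u : (ZMod p)ˣ, ∃ k, k < p ∧ g ^ k = u := by
    intro u
    have hu : u ∈ Submonoid.powers g := (mem_powers_iff_mem_zpowers).2 (hg u)
    obtain ⟨k, hk⟩ := hu
    refine ⟨k % orderOf g, ?_, ?_⟩
    · have hpos : 0 < orderOf g := orderOf_pos g
      have := Nat.mod_lt k hpos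
      have hp1 : 1 ≤ p := hp.out.one_lt.le
      omega
    · rw [pow_mod_orderOf]; exact hk
  choose k hk hgk using key
  refine ⟨⟨(g : ZMod p), g.ne_zero, fun c => if hc : c = 0 then 0 else k (Units.mk0 c hc),
    fun c => ?_, fun c hc => ?_⟩⟩
  · split_ifs with hc
    · exact hp.out.pos
    · exact hk _
  · rw [dif_neg hc, ← Units.val_pow_eq_pow_val, hgk]
    rfl

/-- Powers of the generator are non-zero. [folklore] -/
theorem DlogData.pow_ne_zero {p : ℕ} [Fact p.Prime] (D : DlogData p) (k : ℕ) : D.γ ^ k ≠ 0 :=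
  _root_.pow_ne_zero k D.γ_ne

/-- **A product of non-zero residues is the generator raised to the sum of the logarithms** (Vollmer's eq. (1.5)). [cite: Vollmer1999, §1.4.2, proof of Thm. 1.40, eq. (1.5)] -/
theorem prod_eq_pow_sum_dlog {p : ℕ} (D : DlogData p) {β : Type*} (s : Finset β) (c : β → ZMod p)
    (hc : ∀ i ∈ s, c i ≠ 0) : ∏ i ∈ s, c i = D.γ ^ (∑ i ∈ s, D.dlog (c i)) := by
  rw [← Finset.prod_pow_eq_pow_sum]
  exact Finset.prod_congr rfl fun i hi => (D.pow_dlog (c i) (hc i hi)).symm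

/-- A product of natural numbers vanishes modulo a prime iff some factor does. [folklore] -/
theorem natCast_prod_eq_zero_iff {p : ℕ} [hp : Fact p.Prime] {β : Type*} (s : Finset β) (m : β → ℕ) :
    ((∏ i ∈ s, m i : ℕ) : ZMod p) = 0 ↔ ∃ i ∈ s, (m i : ZMod p) = 0 := by
  rw [Nat.cast_prod, Finset.prod_eq_zero_iff]

/-- **Residue of a product via discrete logarithms**: modulo a prime `p`, the residue of
`∏ mᵢ` is `0` if some `mᵢ ≡ 0`, and otherwise the canonical representative of
`γ ^ (∑ dlog mᵢ)` (eqs. (1.5)–(1.6), with "the particular case that one of the `aᵢ mod p_j` is equal to `0`"). [cite: Vollmer1999, §1.4.2, proof of Thm. 1.40, eqs. (1.5)–(1.6)] -/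
theorem prod_mod_eq {p : ℕ} [hp : Fact p.Prime] (D : DlogData p) {β : Type*} (s : Finset β)
    (m : β → ℕ) :
    (∏ i ∈ s, m i) % p =
      if ∃ i ∈ s, (m i : ZMod p) = 0 then 0
      else (D.γ ^ (∑ i ∈ s, D.dlog (m i : ZMod p))).val := by
  classical
  rw [← ZMod.val_natCast]
  split_ifs with h
  · rw [(natCast_prod_eq_zero_iff s m).2 h, ZMod.val_zero]
  · push Not at h
    rw [Nat.cast_prod, prod_eq_pow_sum_dlog D s (fun i => (m i : ZMod p)) h]

/-! ### CRT tables for a finite set of primes -/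

section CRT

variable (S : Finset ℕ)

/-- The product `M = ∏_{p ∈ S} p`. [folklore] -/
def crtM : ℕ := ∏ p ∈ S, p

variable {S}

/-- `M > 0` for a set of primes. [folklore] -/
theorem crtM_pos (hS : ∀ p ∈ S, p.Prime) : 0 < crtM S :=
  Finset.prod_pos fun p hp => (hS p hp).pos

/-- Each prime divides `M`. [folklore] -/
theorem dvd_crtM {p : ℕ} (hp : p ∈ S) : p ∣ crtM S := Finset.dvd_prod_of_mem _ hp

variable (S)

/-- The cofactor `M / p = ∏_{q ∈ S ∖ {p}} q`. [folklore] -/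
def cof (p : ℕ) : ℕ := ∏ q ∈ S.erase p, q

/-- `cof p · p = M` for `p ∈ S`. [folklore] -/
theorem cof_mul {p : ℕ} (hp : p ∈ S) : cof S p * p = crtM S :=
  Finset.prod_erase_mul _ _ hp

/-- The cofactor is a unit modulo `p` (distinct primes). [folklore] -/
theorem cof_ne_zero (hS : ∀ p ∈ S, p.Prime) {p : ℕ} (hp : p ∈ S) :
    ((cof S p : ℕ) : ZMod p) ≠ 0 := by
  haveI : Fact p.Prime := ⟨hS p hp⟩
  unfold cof
  rw [Nat.cast_prod, Finset.prod_ne_zero_iff]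
  intro q hq
  rw [Finset.mem_erase] at hq
  rw [Ne, ZMod.natCast_eq_zero_iff]
  intro hdvd
  exact hq.1 (((Nat.prime_dvd_prime_iff_eq (hS p hp) (hS q hq.2)).1 hdvd).symm)

/-- **The CRT table**: `crtT S p r ≡ r (mod p)`, `≡ 0 (mod q)` for `q ∈ S ∖ {p}`, and `< M` (the hard-wired numbers `r · r_j · s_j mod p` of Vollmer's eq. (1.7)). [cite: Vollmer1999, §1.4.2, proof of Thm. 1.40, eq. (1.7), and Appendix A7] -/
def crtT (p r : ℕ) : ℕ := (r * (cof S p * (((cof S p : ℕ) : ZMod p)⁻¹).val)) % crtM S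

/-- `crtT < M`. [folklore] -/
theorem crtT_lt (hS : ∀ p ∈ S, p.Prime) (p r : ℕ) : crtT S p r < crtM S :=
  Nat.mod_lt _ (crtM_pos hS)

/-- `crtT S p r ≡ r (mod p)`. [folklore] -/
theorem crtT_mod_self (hS : ∀ p ∈ S, p.Prime) {p : ℕ} (hp : p ∈ S) (r : ℕ) :
    crtT S p r % p = r % p := by
  haveI : Fact p.Prime := ⟨hS p hp⟩
  unfold crtT
  rw [Nat.mod_mod_of_dvd _ (dvd_crtM hp)]
  rw [← ZMod.natCast_eq_natCast_iff']
  push_cast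
  rw [ZMod.natCast_zmod_val, mul_inv_cancel₀ (cof_ne_zero S hS hp), mul_one]

/-- `crtT S p r ≡ 0 (mod q)` for `q ∈ S`, `q ≠ p`. [folklore] -/
theorem crtT_mod_other {p q : ℕ} (hq : q ∈ S) (hqp : q ≠ p) (r : ℕ) :
    crtT S p r % q = 0 := by
  unfold crtT
  rw [Nat.mod_mod_of_dvd _ (dvd_crtM hq)]
  apply Nat.mod_eq_zero_of_dvd
  refine Dvd.dvd.mul_left (Dvd.dvd.mul_right ?_ _) _
  exact Finset.dvd_prod_of_mem _ (Finset.mem_erase.2 ⟨hqp, hq⟩)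

/-- The CRT sum of the residues of `E`. [folklore] -/
def crtSum (E : ℕ) : ℕ := ∑ p ∈ S, crtT S p (E % p)

/-- **CRT reconstruction**: `(∑_{p ∈ S} crtT S p (E % p)) % M = E % M` ("the Chinese Remainder Theorem now tells us that `a = a' mod p`"). [cite: Vollmer1999, §1.4.2, proof of Thm. 1.40, eq. (1.7)] -/
theorem crtSum_mod (hS : ∀ p ∈ S, p.Prime) (E : ℕ) : crtSum S E % crtM S = E % crtM S := by
  -- congruent modulo every `p ∈ S`
  have hmodp : ∀ p ∈ S, crtSum S E % p = E % p := by
    intro p hp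
    unfold crtSum
    rw [Finset.sum_nat_mod, Finset.sum_eq_single p, crtT_mod_self S hS hp, Nat.mod_mod, Nat.mod_mod]
    · intro q hq hqp
      exact crtT_mod_other S hp (Ne.symm hqp) _
    · intro h; exact absurd hp h
  -- hence modulo the product (pairwise coprime)
  have key : ∀ T : Finset ℕ, T ⊆ S → (crtSum S E) ≡ E [MOD ∏ p ∈ T, p] := by
    intro T hT
    induction T using Finset.induction_on with
    | empty => simp [Nat.ModEq, Nat.mod_one]
    | insert q T hqT ih =>
      rw [Finset.prod_insert hqT]
      have hq : q ∈ S := hT (Finset.mem_insert_self _ _)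
      have hTS : T ⊆ S := fun x hx => hT (Finset.mem_insert_of_mem hx)
      have hcop : Nat.Coprime q (∏ p ∈ T, p) := by
        refine Nat.Coprime.prod_right fun p hp => ?_
        have hpS := hTS hp
        have hne : q ≠ p := fun h => hqT (h ▸ hp)
        exact (Nat.coprime_primes (hS q hq) (hS p hpS)).2 hne
      exact (Nat.modEq_and_modEq_iff_modEq_mul hcop).1 ⟨hmodp q hq, ih hTS⟩
  exact key S Finset.Subset.rfl

/-- The CRT quotient `κ = (∑ crtT) / M`. [folklore] -/
def crtK (E : ℕ) : ℕ := crtSum S E / crtM S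

/-- `κ < |S|` (each table entry is `< M`), for nonempty `S`; in general `κ ≤ |S|`. [folklore] -/
theorem crtK_lt (hS : ∀ p ∈ S, p.Prime) (E : ℕ) : crtK S E < S.card + 1 := by
  unfold crtK crtSum
  have hM := crtM_pos hS
  rw [Nat.lt_succ_iff, Nat.div_le_iff_le_mul_add_pred hM]
  have : ∑ p ∈ S, crtT S p (E % p) ≤ crtM S * S.card := by
    calc ∑ p ∈ S, crtT S p (E % p) ≤ ∑ _p ∈ S, crtM S :=
          Finset.sum_le_sum fun p _ => (crtT_lt S hS p _).le
      _ = crtM S * S.card := by rw [Finset.sum_const, smul_eq_mul, mul_comm]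
  omega

/-- **The CRT identity**: for `E < M`, `∑_{p∈S} crtT S p (E % p) = κ M + E` (`a = a' − q·p`). [cite: Vollmer1999, §1.4.2, proof of Thm. 1.40] -/
theorem crtSum_eq (hS : ∀ p ∈ S, p.Prime) {E : ℕ} (hE : E < crtM S) :
    crtSum S E = crtK S E * crtM S + E := by
  have h := Nat.div_add_mod (crtSum S E) (crtM S)
  rw [crtSum_mod S hS E, Nat.mod_eq_of_lt hE] at h
  unfold crtK
  rw [mul_comm]; exact h.symm

/-! ### The approximate quotient formula -/

/-- The number of fractional bits: `2^b = 2^{size (2|S|)}`, so `2|S| < 2^b ≤ 4|S|` (for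
`S ≠ ∅`). [folklore] -/
def apxB : ℕ := Nat.size (2 * S.card)

/-- `2|S| < 2^b`. [folklore] -/
theorem two_card_lt : 2 * S.card < 2 ^ apxB S := Nat.lt_size_self _

/-- `2^b ≤ 4|S| + 1`. [folklore] -/
theorem two_pow_apxB_le : 2 ^ apxB S ≤ 4 * S.card + 1 := by
  unfold apxB
  rcases Nat.eq_zero_or_pos S.card with h | h
  · rw [h]; simp
  · have h1 := Nat.lt_size.1 (show Nat.size (2 * S.card) - 1 < Nat.size (2 * S.card) by
      have : 0 < Nat.size (2 * S.card) := Nat.size_pos.2 (by omega)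
      omega)
    have e : 2 ^ Nat.size (2 * S.card) = 2 * 2 ^ (Nat.size (2 * S.card) - 1) := by
      rw [← pow_succ']; congr 1
      have : 0 < Nat.size (2 * S.card) := Nat.size_pos.2 (by omega)
      omega
    rw [e]; omega

/-- The truncated fractions `ũ_p(r) = ⌊crtT S p r · 2^b / M⌋ < 2^b`. [folklore] -/
def apxU (p r : ℕ) : ℕ := crtT S p r * 2 ^ apxB S / crtM S

/-- `ũ < 2^b`. [folklore] -/
theorem apxU_lt (hS : ∀ p ∈ S, p.Prime) (p r : ℕ) : apxU S p r < 2 ^ apxB S := by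
  unfold apxU
  rw [Nat.div_lt_iff_lt_mul (crtM_pos hS), mul_comm (2 ^ apxB S) (crtM S)]
  exact Nat.mul_lt_mul_of_lt_of_le (crtT_lt S hS p r) le_rfl (Nat.two_pow_pos _)

/-- **The approximate quotient formula**: if `4E < M` then
`κ = (∑_{p ∈ S} ũ_p(E % p) + |S|) / 2^b` — the quotient `q` read off a small weighted sum of truncated fractions instead of Vollmer's parallel comparisons `i·p ≤ a' < (i+1)·p`; cf. Vollmer 1999, proof of Thm. 1.40 (determination of `q` by comparisons) and Naor–Reingold 2004, §4.2.1 (p. 252: the CRT representation of the exponent suffices). [folklore] -/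
theorem crtK_eq_approx (hS : ∀ p ∈ S, p.Prime) {E : ℕ} (hE : 4 * E < crtM S) :
    crtK S E = (∑ p ∈ S, apxU S p (E % p) + S.card) / 2 ^ apxB S := by
  rcases S.eq_empty_or_nonempty with hSe | hne
  · subst hSe
    simp [crtK, crtSum]
  set M := crtM S with hMdef
  set b := apxB S with hb
  set κ := crtK S E with hκ
  have hM : 0 < M := crtM_pos hS
  have hEM : E < M := by omega
  have hsum : crtSum S E = κ * M + E := crtSum_eq S hS hEM
  -- `M ũ_p ≤ T_p 2^b < M ũ_p + M`
  have hlow : ∀ p, crtT S p (E % p) * 2 ^ b < M * apxU S p (E % p) + M := fun p => by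
    unfold apxU
    rw [← hMdef, ← hb]
    have := Nat.lt_div_mul_add (a := crtT S p (E % p) * 2 ^ b) hM
    linarith
  have hup : ∀ p, M * apxU S p (E % p) ≤ crtT S p (E % p) * 2 ^ b := fun p => by
    unfold apxU; rw [← hMdef, ← hb, mul_comm]; exact Nat.div_mul_le_self _ _
  -- sum over `S`
  set U := ∑ p ∈ S, apxU S p (E % p) with hU
  have hsumT : ∑ p ∈ S, crtT S p (E % p) * 2 ^ b = (κ * M + E) * 2 ^ b := by
    rw [← Finset.sum_mul, ← hsum]; rfl
  have hL : (κ * M + E) * 2 ^ b < M * U + S.card * M := by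
    rw [← hsumT, hU, Finset.mul_sum]
    calc ∑ p ∈ S, crtT S p (E % p) * 2 ^ b < ∑ p ∈ S, (M * apxU S p (E % p) + M) :=
          Finset.sum_lt_sum_of_nonempty hne fun p _ => hlow p
      _ = ∑ p ∈ S, M * apxU S p (E % p) + S.card * M := by
          rw [Finset.sum_add_distrib, Finset.sum_const, smul_eq_mul]
  have hR : M * U ≤ (κ * M + E) * 2 ^ b := by
    rw [← hsumT, hU, Finset.mul_sum]
    exact Finset.sum_le_sum fun p _ => hup p
  symm
  apply Nat.div_eq_of_lt_le
  · -- `κ 2^b ≤ U + |S|`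
    have h1 : M * (κ * 2 ^ b) < M * (U + S.card) := by
      calc M * (κ * 2 ^ b) = κ * M * 2 ^ b := by ring
        _ ≤ (κ * M + E) * 2 ^ b := Nat.mul_le_mul_right _ (Nat.le_add_right _ _)
        _ < M * U + S.card * M := hL
        _ = M * (U + S.card) := by ring
    exact (Nat.lt_of_mul_lt_mul_left h1).le
  · -- `U + |S| < (κ + 1) 2^b`
    have h2 : 4 * E * 2 ^ b < M * 2 ^ b := Nat.mul_lt_mul_of_pos_right hE (Nat.two_pow_pos _)
    have h3 : M * (4 * U) < M * (4 * (κ * 2 ^ b) + 2 ^ b) := by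
      calc M * (4 * U) = 4 * (M * U) := by ring
        _ ≤ 4 * ((κ * M + E) * 2 ^ b) := Nat.mul_le_mul_left _ hR
        _ = 4 * (κ * M) * 2 ^ b + 4 * E * 2 ^ b := by ring
        _ < 4 * (κ * M) * 2 ^ b + M * 2 ^ b := Nat.add_lt_add_left h2 _
        _ = M * (4 * (κ * 2 ^ b) + 2 ^ b) := by ring
    have h4 := Nat.lt_of_mul_lt_mul_left h3
    have h5 := two_card_lt S
    rw [← hb] at h5
    rw [Nat.succ_mul]
    omega

end CRT

end SmallPrimes

end Literature.Computability.Complexity
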